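import Summits.QuantumFields.YangMills.Theorems.ParabolicTrajectoryContinuumLimitOnTrajectoryDefs

/-!
# Route `ParabolicTrajectory`, crux `ContinuumLimitOnTrajectory` (stmt-QuantumFields-10522), line `two-orbit-synchronisation`: stub `stub_anatomy`

Support file for item stmt-QuantumFields-10522 (route `ParabolicTrajectory` of `YangMills`), registered stub
`stub_anatomy : Anatomy` of the skeleton `Cruxes/ContinuumLimitOnTrajectory/Lines/two_orbit_synchronisation.lean`
(vocabulary: `TwoOrbitChart`, `Anatomy` of `ParabolicTrajectoryContinuumLimitOnTrajectoryDefs`).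

**Orbit anatomy of a tuned sequence**, from the chart FIELDS alone (`orb_zero`, `drift`, `absorb`,
`betaOf_bddOn`, `uv_small`, `exit_massive`, `j₀`; nothing analytic):
* `betaOf_bddOn` + `betaOf (g k) → ∞` + eventually `g k ∈ (0, g₀]` force `g k → 0⁺` (eventually below every
  `g₁ > 0`);
* along a `γ'`-history (`γ' ≤ γ`, `8 b γ'² ≤ 1`) the marginal coordinate stays `≥ g > 0` and grows by a factor
  `≤ 5/4` per step (`drift`), so it is `≤ (5/4)^i g` at step `i`;
* the uniform offset `m` is the `m₀` of `exit_massive` at `ε = θ/2`, the terminal step is `J k = n k - m`: were the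
  `γ'`-history to fail by step `J k`, its last good step `N < J k` would satisfy `j₀ ≤ N` (geometric growth from
  `g k < γ' (4/5)^{j₀}`) and `(orb (g k) N).1 ≥ (4/5) γ' ≥ γ'/2`, so the readout at offset `n k - N ≥ m` — which is
  the tuning value `(M^{n k})⁸ corrInf (g k) (M^{n k})` — would be `≤ θ/2`, contradicting its convergence to `θ`;
* `absorb` gives the small fibres from `j₀` on, and `uv_small m 1 (θ/2)` gives the floor `g_low`, again because the
  readout at `J k + m = n k` is the tuning value, eventually `> θ/2`.
No definitions are introduced; `M = 0, 1` are covered (the tuning hypothesis is only used through its eventual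
value at index `n k`).
-/

open Filter Topology
open Literature.MathematicalPhysics.QuantumFieldTheory

namespace Summit.QuantumFields.YangMills.Cruxes.ContinuumLimitOnTrajectory.TwoOrbitSynchronisation

section AnatomyProof

variable {G : Type} [Group G] [TopologicalSpace G] [IsTopologicalGroup G] [CompactSpace G]
  [MeasurableSpace G] [BorelSpace G] {r : LatticeRep G} {M : ℕ}

/-- One drift step inside the sub-window `[0, c]` grows the marginal coordinate by a factor at most `5/4`
when `8 b c² ≤ 1`: from `y ≤ x + 2 b x³`, `0 ≤ x ≤ c` we get `y ≤ (5/4) x`. -/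
private theorem step_le_five_fourths {b c x y : ℝ} (hb : 8 * b * c ^ 2 ≤ 1) (hb0 : 0 ≤ b)
    (hx0 : 0 ≤ x) (hxc : x ≤ c) (hy : y ≤ x + 2 * b * x ^ 3) : y ≤ 5 / 4 * x := by
  have h1 : x ^ 2 ≤ c ^ 2 := pow_le_pow_left₀ hx0 hxc 2
  have h2 : 2 * b * x ^ 2 ≤ 1 / 4 := by
    have := mul_le_mul_of_nonneg_left h1 (by positivity : (0 : ℝ) ≤ 2 * b)
    linarith
  calc y ≤ x + 2 * b * x ^ 3 := hy
    _ = x + 2 * b * x ^ 2 * x := by ring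
    _ ≤ x + 1 / 4 * x := by gcongr
    _ = 5 / 4 * x := by ring

/-- **First exit.** If the `c`-history of a real sequence fails by step `J` but holds at step `0`, there is
a last good step `N < J`: the history holds through `N` and `x (N + 1) > c`. -/
private theorem exists_first_exit {x : ℕ → ℝ} {c : ℝ} (h0 : x 0 ≤ c) :
    ∀ J : ℕ, ¬ (∀ i ≤ J, x i ≤ c) → ∃ N : ℕ, N < J ∧ (∀ i ≤ N, x i ≤ c) ∧ c < x (N + 1) := by
  intro J
  induction J with
  | zero =>
    intro h
    exact absurd (fun i hi => by rw [Nat.le_zero.mp hi]; exact h0) h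
  | succ J ih =>
    intro h
    by_cases hJ : ∀ i ≤ J, x i ≤ c
    · refine ⟨J, J.lt_succ_self, hJ, ?_⟩
      by_contra hc
      push Not at hc
      refine h fun i hi => ?_
      by_cases e : i = J + 1
      · rw [e]; exact hc
      · exact hJ i (by omega)
    · obtain ⟨N, hN, hH, hc⟩ := ih hJ
      exact ⟨N, hN.trans J.lt_succ_self, hH, hc⟩

/-- **`β → ∞` forces `g → 0⁺`.** Along couplings eventually in `(0, g₀]` with `betaOf (g k) → ∞`, for every
`g₁ > 0` eventually `g k < g₁` (the dictionary is bounded on `[g₁, g₀]`, field `betaOf_bddOn`). -/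
private theorem eventually_coupling_lt (𝒞 : TwoOrbitChart G r M) {g : ℕ → ℝ}
    (hg : ∀ᶠ k in atTop, g k ∈ Set.Ioc (0 : ℝ) 𝒞.g₀)
    (hbeta : Tendsto (fun k => 𝒞.betaOf (g k)) atTop atTop) {g₁ : ℝ} (hg₁ : 0 < g₁) :
    ∀ᶠ k in atTop, g k < g₁ := by
  obtain ⟨B, hB⟩ := 𝒞.betaOf_bddOn g₁ hg₁
  filter_upwards [hg, hbeta.eventually_gt_atTop B] with k hk hkB
  by_contra h
  exact absurd (hB (g k) ⟨not_lt.mp h, hk.2⟩) (not_le.mpr hkB)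

/-- **In-window orbit bounds (asymptotic freedom).** Along a `γ'`-history (`γ' ≤ γ`, `8 b γ'² ≤ 1`) started
at `g ∈ (0, g₀]`, the marginal coordinate never drops below `g` (drift lower bound, `b > 0`) and grows at
most geometrically with ratio `5/4` (drift upper bound). -/
private theorem orb_fst_bounds (𝒞 : TwoOrbitChart G r M) {γ' : ℝ} (hγ'γ : γ' ≤ 𝒞.γ)
    (hb : 8 * 𝒞.b * γ' ^ 2 ≤ 1) {g : ℝ} (hg : g ∈ Set.Ioc (0 : ℝ) 𝒞.g₀) :
    ∀ i : ℕ, (∀ i' < i, (𝒞.orb g i').1 ≤ γ') →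
      g ≤ (𝒞.orb g i).1 ∧ (𝒞.orb g i).1 ≤ (5 / 4 : ℝ) ^ i * g := by
  intro i
  induction i with
  | zero =>
    intro _
    simp [𝒞.orb_zero g]
  | succ i ih =>
    intro hH
    have hHi : ∀ i' ≤ i, (𝒞.orb g i').1 ≤ γ' := fun i' hi' => hH i' (Nat.lt_succ_of_le hi')
    obtain ⟨hlo, hup⟩ := ih fun i' hi' => hH i' (hi'.trans i.lt_succ_self)
    have hx0 : 0 ≤ (𝒞.orb g i).1 := hg.1.le.trans hlo
    obtain ⟨hd1, hd2⟩ := 𝒞.drift g hg i fun i' hi' => (hHi i' hi').trans hγ'γ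
    have hstep : (𝒞.orb g (i + 1)).1 ≤ 5 / 4 * (𝒞.orb g i).1 :=
      step_le_five_fourths hb 𝒞.b_pos.le hx0 (hHi i le_rfl) hd2
    refine ⟨?_, ?_⟩
    · calc g ≤ (𝒞.orb g i).1 := hlo
        _ ≤ (𝒞.orb g i).1 + 𝒞.b / 2 * (𝒞.orb g i).1 ^ 3 :=
          le_add_of_nonneg_right (mul_nonneg (div_nonneg 𝒞.b_pos.le (by norm_num)) (pow_nonneg hx0 3))
        _ ≤ (𝒞.orb g (i + 1)).1 := hd1
    · calc (𝒞.orb g (i + 1)).1 ≤ 5 / 4 * (𝒞.orb g i).1 := hstep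
        _ ≤ 5 / 4 * ((5 / 4 : ℝ) ^ i * g) := by gcongr
        _ = (5 / 4 : ℝ) ^ (i + 1) * g := by ring

end AnatomyProof

/-- **Stub 3 — orbit anatomy of a tuned sequence** (`stub_anatomy : Anatomy`), from the chart fields alone.
Mechanism: `betaOf_bddOn` + `betaOf (g k) → ∞` force `g k → 0⁺`; along a `γ'`-history the marginal coordinate
stays `≥ g k > 0` and grows by a factor `≤ 5/4` per step (`drift`, `8 b γ'² ≤ 1`); `exit_massive` (at `ε = θ/2`)
yields the uniform offset `m`: if the `γ'`-history failed before step `n k - m`, the last good step `N` would be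
`≥ j₀` (geometric growth from a tiny `g k`) with terminal coupling `≥ (4/5) γ' ≥ γ'/2`, and the readout at offset
`n k - N ≥ m` — which IS the tuning value — would be `≤ θ/2 < θ`; `absorb` gives the small fibres and `uv_small`
(at `ε = θ/2`) the floor `g_low`, again because the readout at `J k + m = n k` is the tuning value. -/
theorem stub_anatomy : Anatomy := by
  intro G _ _ _ _ _ _ r M 𝒞 γ' hγ' hγ'γ hb θ g n hθ hg hbeta hn htune
  obtain ⟨m₀, hm₀⟩ := 𝒞.exit_massive γ' hγ' hγ'γ (θ / 2) (half_pos hθ)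
  obtain ⟨gε, hgε, hsmall⟩ := 𝒞.uv_small m₀ 1 (θ / 2) (half_pos hθ)
  refine ⟨m₀, gε, fun k => n k - m₀, hgε, (tendsto_sub_atTop_nat m₀).comp hn, ?_⟩
  have hE2 : ∀ᶠ k in atTop, θ / 2 < ((M : ℝ) ^ n k) ^ 8 * 𝒞.corrInf (g k) (M ^ n k) :=
    htune.eventually (lt_mem_nhds (half_lt_self hθ))
  have hE3 : ∀ᶠ k in atTop, m₀ + 𝒞.j₀ ≤ n k := hn.eventually_ge_atTop _
  have hq1 : (4 / 5 : ℝ) ^ 𝒞.j₀ ≤ 1 := pow_le_one₀ (by norm_num) (by norm_num)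
  have hg₁pos : 0 < γ' * (4 / 5 : ℝ) ^ 𝒞.j₀ := by positivity
  have hE4 : ∀ᶠ k in atTop, g k < γ' * (4 / 5 : ℝ) ^ 𝒞.j₀ := eventually_coupling_lt 𝒞 hg hbeta hg₁pos
  filter_upwards [hg, hE2, hE3, hE4] with k hk hT hnk hkg₁
  have hkγ' : g k ≤ γ' := by
    have : γ' * (4 / 5 : ℝ) ^ 𝒞.j₀ ≤ γ' * 1 := by gcongr
    linarith
  have hbnd := orb_fst_bounds 𝒞 hγ'γ hb hk
  -- the `γ'`-history holds through the terminal step `n k - m₀`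
  have hHist : ∀ i ≤ n k - m₀, (𝒞.orb (g k) i).1 ≤ γ' := by
    by_contra hcon
    have h0 : (𝒞.orb (g k) 0).1 ≤ γ' := by rw [𝒞.orb_zero]; exact hkγ'
    obtain ⟨N, hNJ, hHN, hexit⟩ := exists_first_exit h0 (n k - m₀) hcon
    obtain ⟨hloN, -⟩ := hbnd N fun i' hi' => hHN i' hi'.le
    obtain ⟨-, hupN1⟩ := hbnd (N + 1) fun i' hi' => hHN i' (Nat.lt_succ_iff.mp hi')
    have hxN0 : 0 ≤ (𝒞.orb (g k) N).1 := hk.1.le.trans hloN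
    have hstep : (𝒞.orb (g k) (N + 1)).1 ≤ 5 / 4 * (𝒞.orb (g k) N).1 :=
      step_le_five_fourths hb 𝒞.b_pos.le hxN0 (hHN N le_rfl)
        (𝒞.drift (g k) hk N fun i' hi' => (hHN i' hi').trans hγ'γ).2
    have hhalf : γ' / 2 ≤ (𝒞.orb (g k) N).1 := by linarith
    have hj₀N : 𝒞.j₀ ≤ N := by
      by_contra hlt
      push Not at hlt
      have hpow : (5 / 4 : ℝ) ^ (N + 1) ≤ (5 / 4 : ℝ) ^ 𝒞.j₀ :=
        pow_le_pow_right₀ (by norm_num) (Nat.succ_le_of_lt hlt)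
      have hone : (5 / 4 : ℝ) ^ 𝒞.j₀ * (γ' * (4 / 5 : ℝ) ^ 𝒞.j₀) = γ' := by
        rw [mul_left_comm, ← mul_pow]; norm_num
      have h1 : (5 / 4 : ℝ) ^ (N + 1) * g k ≤ (5 / 4 : ℝ) ^ 𝒞.j₀ * g k :=
        mul_le_mul_of_nonneg_right hpow hk.1.le
      have h2 : (5 / 4 : ℝ) ^ 𝒞.j₀ * g k < (5 / 4 : ℝ) ^ 𝒞.j₀ * (γ' * (4 / 5 : ℝ) ^ 𝒞.j₀) :=
        mul_lt_mul_of_pos_left hkg₁ (by positivity)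
      linarith
    have key := hm₀ (n k - N) (by omega) (g k) hk N hj₀N hHN hhalf
    rw [show N + (n k - N) = n k by omega, one_mul] at key
    linarith [le_abs_self (((M : ℝ) ^ n k) ^ 8 * 𝒞.corrInf (g k) (M ^ n k))]
  have hJm : n k - m₀ + m₀ = n k := Nat.sub_add_cancel (by omega)
  refine ⟨hJm, by omega, fun i hi => ⟨hk.1.le.trans (hbnd i fun i' hi' => hHist i' (by omega)).1,
    hHist i hi⟩, fun i hj₀i hiJ => 𝒞.absorb (g k) hk i hj₀i fun i' hi' =>
      (hHist i' (hi'.trans hiJ)).trans hγ'γ, ?_⟩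
  by_contra hcon
  push Not at hcon
  have key := hsmall (g k) hk (n k - m₀) (by omega) (fun i hi => (hHist i hi).trans hγ'γ) hcon.le
  rw [hJm, one_mul] at key
  linarith [le_abs_self (((M : ℝ) ^ n k) ^ 8 * 𝒞.corrInf (g k) (M ^ n k))]

end Summit.QuantumFields.YangMills.Cruxes.ContinuumLimitOnTrajectory.TwoOrbitSynchronisation
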